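import Literature.NumberTheory.Automorphic.KimExteriorSquareGL4ArchimedeanProofs
import Literature.NumberTheory.Automorphic.KimExteriorSquareGL4Twist
import Literature.NumberTheory.Automorphic.ArchParameterTwistNorm
import HarnessLib

/-!
# Kim's exterior square `GL₄ → GL₆`, archimedean clause: the conclusion of Theorem A is invariant
# under the twists `π ↦ π ⊗ |det|^s` and reduces to unitary-normalised cuspidal data

Sibling proof file (theorems only; no `sorry`, no definition, no named fact) of
`Literature.NumberTheory.Automorphic.KimExteriorSquareGL4Archimedean`, whose named fact
`Kim2003_exteriorSquare_GL4_archimedean` renders H. H. Kim, *Functoriality for the exterior square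
of `GL₄` and the symmetric fourth of `GL₂`*, J. Amer. Math. Soc. **16** (2003) 139–183 [Kim2002],
Theorem A (p. 139) = Thm. 5.3.1 (p. 165) with its archimedean clause (ii): *if `π` has archimedean
(Harish-Chandra) parameter `χ`, the lift `Π` has parameter `σ ↦ ∧²(χ σ) = {aᵢ + aⱼ : i < j}`*.
It is the archimedean companion of `KimExteriorSquareGL4Twist` / `KimExteriorSquareGL4Reduction`
(which treat the Satake clauses (i), (iii)).

Kim's standing convention (p. 139): *"In what follows, a cuspidal representation always means a
unitary one."* The fact is stated for **every** cuspidal Borel–Jacquet datum `π = W / W'` on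
`GL₄(𝔸_F)`; its docstring justifies this by the normalisation `π = π⁰ ⊗ |det|^s`:
"`∧²(π ⊗ |det|^s) = ∧²π ⊗ |det|^{2s}` shifts every archimedean exponent by `2s`, and
`wedgeTwoArchParams` of a parameter shifted by `s` is shifted by `2s`". This file PROVES that
sentence at the level of automorphic representation data, using the archimedean parameter of a
norm twist (`AutomorphicRepData.HasArchParameter.of_map_mulChar_detTwist`, file
`ArchParameterTwistNorm`: the parameter of `π ⊗ |det|_𝔸^s`, `s ∈ ℝ`, is `σ ↦ χ_π(σ) + s`;
Borel–Jacquet 1979, 5.7) and the twist rule `wedgeTwoArchParams_map_add`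
(`∧²(χ + s) = ∧²χ + 2s`, file `KimExteriorSquareGL4ArchimedeanProofs`):

* `AutomorphicRepData.card_eq_of_hasArchParameter` — an archimedean parameter of a datum on
  `GL_n(𝔸_K)` has `n` entries at every complex embedding (bookkeeping; Clozel 1990, §3.3).
* `Kim2003_exteriorSquare_GL4_archimedean.conclusion_of_twist_norm` — **twist invariance, all
  three clauses**: if the conclusion of the fact (Satake clause (i), archimedean clause (ii),
  isobaric clause (iii), spelled out verbatim) holds for a cuspidal `π` on `GL₄(𝔸_F)`, then it
  holds for `π₁ = π ⊗ |det|_𝔸^s` (`s ∈ ℝ`; Borel–Jacquet model `π₁.W = π.W · c`, `π₁.W' = π.W' · c`,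
  `c = χ ∘ det`, `χ = ‖·‖^s`), with `P₁ = P ⊗ (χ² ∘ det)` and `σᵢ ⊗ (χ² ∘ det)`: on Satake
  parameters `∧²(χ(ϖ_v) α) = χ(ϖ_v)² ∧²α` (as in `Kim2003_exteriorSquare_GL4.conclusion_of_twist`),
  and on archimedean parameters `∧²(χ₁ - s) + 2s = ∧²χ₁`.
* `Kim2003_exteriorSquare_GL4_archimedean.conclusion_of_isNearlyEquivalent` — the conclusion
  passes from `π` to any nearly equivalent cuspidal `π₁` whose archimedean parameters are
  archimedean parameters of `π` (same `P`, same `σᵢ`; uniqueness of Satake parameters,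
  `hasSatakeParamAt_unique_holds`, Flath 1979 Thm. 3). This isolates what a clean model
  `π₀ = C / ⊥` of `π` (file `AutomorphicRepsGLCleanModel`) must supply beyond Satake parameters for
  the archimedean clause: `C ≅ W / W'` as `(𝔤, K_∞)`-modules, hence the same infinitesimal character.
* `Kim2003_exteriorSquare_GL4_archimedean_of_re_centralExponent_eq_zero` — **reduction to
  unitary-normalised data**: the fact follows from its case of cuspidal `π` whose archimedean
  parameter `χ` (if any) has purely imaginary total exponent, `Re ∑_σ ∑ᵢ χ(σ)ᵢ = 0`. That number is
  the exponent `μ` by which the split component `A_G = ℝ_{>0}` of the centre acts on `π_∞`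
  (`a ↦ a^μ`: the central element `1 ∈ 𝔤𝔩₄(F_w)` acts through the infinitesimal character by
  `∑ᵢ aᵢ` at a real place and `∑ᵢ aᵢ + ∑ᵢ bᵢ` at a complex one), and `Re μ = 0` says that the
  central character of `π_∞` is unitary on `A_G`, i.e. — for an irreducible cuspidal automorphic
  representation — that `π` is unitary, Kim's hypothesis. Proof: twist by `|det|_𝔸^s`, `s = -Re μ / 4[F:ℚ]` (`exists_heckeCharacter_ideleNorm_cpow`,
  `exists_cuspidalAutomorphicRepData_twist_hecke`), read the new exponent off
  `HasArchParameter.of_map_mulChar_detTwist` and the uniqueness of archimedean parameters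
  (`hasArchParameter_unique`), and come back with `conclusion_of_twist_norm` for `‖·‖^{-s}`.

Nothing here assumes the fact; the discharge `Kim2003_exteriorSquare_GL4_archimedean_holds` is not
attempted (its printed proof, Thm. 5.3.1, rests on the weak lift Thm. 4.2.3 = the tree's unproved
`Kim2003_exteriorSquare_GL4`, the converse theorem and the Langlands–Shahidi method; see the module
docstring of `KimExteriorSquareGL4Proofs`, "Status of the discharge").

## References

* [Kim2002] H. H. Kim, J. Amer. Math. Soc. 16 (2003): §1 p. 139 (convention; `∧²π_v` at
  archimedean `v` via Langlands' correspondence), Theorem A (p. 139), Thm. 5.3.1 (p. 165).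
* A. Borel, H. Jacquet, *Automorphic forms and automorphic representations*, Corvallis (1979),
  Part 1, §4.6 and 5.7 ("we may assume `π` unitary") [BorelJacquet1979].
* K. Buzzard, T. Gee, *The conjectural connections between automorphic representations and Galois
  representations* (2014), §3.1, §5.3 [BuzzardGee2014].
* L. Clozel, *Motifs et formes automorphes* (1990), §3.3 [Clozel1990].
-/

noncomputable section

open scoped MatrixGroups Classical NumberField
open NumberField NumberField.InfinitePlace IsDedekindDomain Filter
open Literature.NumberTheory.GaloisRepresentations (HeckeCharacter ideleGroup)

namespace Literature.NumberTheory.Automorphic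

/-! ### Bookkeeping: multisets, values of Hecke characters, norm-power characters -/

section Bookkeeping

/-- `(∑ᵢ βᵢ).map f = ∑ᵢ (βᵢ.map f)` (`Multiset.map` is additive). [folklore] -/
private theorem multiset_map_sum' {ι : Type*} (s : Finset ι) (β : ι → Multiset ℂ) (f : ℂ → ℂ) :
    (∑ i ∈ s, β i).map f = ∑ i ∈ s, (β i).map f := by
  simpa only [Multiset.coe_mapAddMonoidHom] using map_sum (Multiset.mapAddMonoidHom f) β s

/-- Scaling by `a` and then by `b` with `b a = 1` is the identity on multisets. [folklore] -/
private theorem map_mul_map_mul_of_mul_eq_one' {a b : ℂ} (h : b * a = 1) (α : Multiset ℂ) :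
    (α.map (a * ·)).map (b * ·) = α := by
  rw [Multiset.map_map, Function.comp_def]
  simp_rw [← mul_assoc, h, one_mul]
  exact Multiset.map_id' α

/-- Shifting by `a` and then by `b` with `a + b = 0` is the identity on multisets. [folklore] -/
private theorem map_add_map_add_of_add_eq_zero {a b : ℂ} (h : a + b = 0) (α : Multiset ℂ) :
    (α.map (· + a)).map (· + b) = α := by
  rw [Multiset.map_map, Function.comp_def]
  simp_rw [add_assoc, h, add_zero]
  exact Multiset.map_id' α

variable {K : Type} [Field K] [NumberField K]

/-- `χ(ϖ_v) ≠ 0` (a value of a character into `ℂˣ`). [folklore] -/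
private theorem valueAtUniformizer_ne_zero'' (χ : HeckeCharacter K) (v : HeightOneSpectrum (𝓞 K)) :
    χ.valueAtUniformizer v ≠ 0 :=
  Units.ne_zero _

/-- The idelic norm is positive (as a complex number, it is nonzero). [folklore] -/
private theorem ideleNorm_coe_ne_zero (x : ideleGroup K) :
    (GaloisRepresentations.ideleNorm x : ℂ) ≠ 0 := by
  rw [← coe_ideleNorm]
  exact Complex.ofReal_ne_zero.2 (NNReal.coe_ne_zero.2 (ideleNorm_ne_zero x))

/-- `(‖·‖^s)⁻¹ = ‖·‖^{-s}` (`s` real). [folklore] -/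
private theorem inv_apply_eq_ideleNorm_cpow_neg {χ : HeckeCharacter K} {s : ℝ}
    (hχ : ∀ x : ideleGroup K,
      ((χ x : ℂˣ) : ℂ) = (GaloisRepresentations.ideleNorm x : ℂ) ^ ((s : ℝ) : ℂ))
    (x : ideleGroup K) :
    ((χ⁻¹ x : ℂˣ) : ℂ) = (GaloisRepresentations.ideleNorm x : ℂ) ^ (((-s : ℝ) : ℝ) : ℂ) := by
  rw [GaloisRepresentations.HeckeCharacter.inv_apply, Units.val_inv_eq_inv_val, hχ,
    Complex.ofReal_neg, Complex.cpow_neg]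

/-- `(‖·‖^s)² = ‖·‖^{2s}` (`s` real). [folklore] -/
private theorem mul_self_apply_eq_ideleNorm_cpow_two_mul {χ : HeckeCharacter K} {s : ℝ}
    (hχ : ∀ x : ideleGroup K,
      ((χ x : ℂˣ) : ℂ) = (GaloisRepresentations.ideleNorm x : ℂ) ^ ((s : ℝ) : ℂ))
    (x : ideleGroup K) :
    (((χ * χ) x : ℂˣ) : ℂ) = (GaloisRepresentations.ideleNorm x : ℂ) ^ (((2 * s : ℝ) : ℝ) : ℂ) := by
  rw [GaloisRepresentations.HeckeCharacter.mul_apply, Units.val_mul, hχ,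
    ← Complex.cpow_add _ _ (ideleNorm_coe_ne_zero x)]
  congr 1
  push_cast
  ring

end Bookkeeping

/-! ### An archimedean parameter on `GL_n` has `n` entries at every embedding -/

section Card

variable {n : ℕ} {K : Type} [Field K] [NumberField K] {hcpt : isCompact_glFiniteIntegralLevel n K}

/-- **An archimedean parameter of a datum on `GL_n(𝔸_K)` has `n` entries at every complex
embedding** `σ` (`σ` is `w.embedding` for the real place `w = mk σ`, or one of `w.embedding`,
`conj ∘ w.embedding` for the complex place `w = mk σ`, and Harish-Chandra parameters of
`𝔤𝔩_n(K_w)`-modules have `n` entries, `card_eq_of_hasHCParameter`). Clozel 1990, §3.3.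
[cite: Clozel1990, §3.3] -/
theorem AutomorphicRepData.card_eq_of_hasArchParameter
    {π : AutomorphicRepData (AutomorphyDatum.gl n K hcpt)} {χ : (K →+* ℂ) → Multiset ℂ}
    (h : π.HasArchParameter χ) (σ : K →+* ℂ) : Multiset.card (χ σ) = n := by
  obtain ⟨ρ, -, hre, hco⟩ := h
  rcases (InfinitePlace.mk σ).isReal_or_isComplex with hw | hw
  · -- real place: `σ = (mk σ).embedding`
    have h1 := (hre ⟨InfinitePlace.mk σ, hw⟩).1 (Algebra.ofId ℝ ℂ)
    dsimp only at h1
    rwa [embedding_mk_eq_of_isReal (isReal_mk_iff.mp hw)] at h1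
  · -- complex place: `σ ∈ {w.embedding, conj ∘ w.embedding}`, `w = mk σ`
    rcases InfinitePlace.mk_eq_iff.mp (InfinitePlace.mk_embedding (InfinitePlace.mk σ)) with hσ | hσ
    · have h1 := (hco ⟨InfinitePlace.mk σ, hw⟩).1 (AlgHom.id ℝ ℂ)
      dsimp only at h1
      rwa [algHomId_toRingHom_comp, hσ] at h1
    · have h1 := (hco ⟨InfinitePlace.mk σ, hw⟩).1 (Complex.conjAe : ℂ →ₐ[ℝ] ℂ)
      dsimp only at h1
      rwa [conjAe_toRingHom_comp, hσ] at h1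

end Card

/-! ### Invariance of the conclusion of Theorem A (with its archimedean clause) -/

section Kim

variable (F : Type) [Field F] [NumberField F] (hF : ∀ m : ℕ, isCompact_glFiniteIntegralLevel m F)

/-- **Twist invariance of the conclusion of Kim's Theorem A, archimedean clause included**
(Kim 2003, p. 139: "a cuspidal representation always means a unitary one", the general case being
a twist `π⁰ ⊗ |det|^s`; `∧²(π ⊗ |det|^s) = ∧²π ⊗ |det|^{2s}`). Let `χ = ‖·‖^s` (`s ∈ ℝ`) and
`π₁ = π ⊗ (χ ∘ det)` a norm twist of the cuspidal datum `π` on `GL₄(𝔸_F)` (Borel–Jacquet model: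
`π₁.W = π.W · (χ∘det)`, `π₁.W' = π.W' · (χ∘det)`). If the conclusion of
`Kim2003_exteriorSquare_GL4_archimedean` holds for `π` — an automorphic `P` on `GL₆(𝔸_F)` with
(i) `t_{P,v} = ∧² t_{π,v}` a.e., (ii) archimedean parameter `σ ↦ ∧²(χ_π σ)` whenever `π` has
archimedean parameter `χ_π`, (iii) cuspidal `σᵢ` on `GL_{nᵢ}`, `∑ nᵢ = 6`, with
`t_{P,v} = ⊎ᵢ t_{σᵢ,v}` a.e. — then it holds for `π₁`, with `P₁ = P ⊗ (χ² ∘ det)` and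
`σᵢ ⊗ (χ² ∘ det)`: (i), (iii) on Satake parameters as in `Kim2003_exteriorSquare_GL4.conclusion_of_twist`
(`∧²(χ(ϖ_v) α) = χ(ϖ_v)² ∧²α`, `wedgeTwoParams_map_mul`); (ii) because an archimedean parameter `χ₁`
of `π₁` gives the parameter `χ₁ - s` of `π = π₁ ⊗ |det|^{-s}`, hence `∧²(χ₁ - s) = ∧²χ₁ - 2s` of `P`
(`wedgeTwoArchParams_map_add`) and `∧²χ₁` of `P₁ = P ⊗ |det|^{2s}`
(`HasArchParameter.of_map_mulChar_detTwist`, Borel–Jacquet 1979, 5.7).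
[cite: Kim2002, §1 p. 139 (convention) and Theorem A] -/
theorem Kim2003_exteriorSquare_GL4_archimedean.conclusion_of_twist_norm
    {χ : HeckeCharacter F} {s : ℝ}
    (hχ : ∀ x : ideleGroup F,
      ((χ x : ℂˣ) : ℂ) = (GaloisRepresentations.ideleNorm x : ℂ) ^ ((s : ℝ) : ℂ))
    {π π₁ : CuspidalAutomorphicRepData 4 F (hF 4)}
    (hW : π₁.1.W = π.1.W.map (mulChar (detTwist 4 χ)))
    (hW' : π₁.1.W' = π.1.W'.map (mulChar (detTwist 4 χ)))
    (h : ∃ P : AutomorphicRepData (AutomorphyDatum.gl 6 F (hF 6)),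
      (∀ᶠ v : HeightOneSpectrum (𝓞 F) in cofinite, ∀ α : Multiset ℂ,
        π.1.HasSatakeParamAt v α → P.HasSatakeParamAt v (wedgeTwoParams α)) ∧
      (∀ χ₀ : (F →+* ℂ) → Multiset ℂ, π.1.HasArchParameter χ₀ →
        P.HasArchParameter fun σ : F →+* ℂ => wedgeTwoArchParams (χ₀ σ)) ∧
      ∃ (k : ℕ) (m : Fin k → ℕ) (σ : ∀ i : Fin k, CuspidalAutomorphicRepData (m i) F (hF (m i))),
        (∑ i, m i = 6) ∧
        ∀ᶠ v : HeightOneSpectrum (𝓞 F) in cofinite, ∀ β : Fin k → Multiset ℂ,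
          (∀ i, (σ i).1.HasSatakeParamAt v (β i)) → P.HasSatakeParamAt v (∑ i, β i)) :
    ∃ P₁ : AutomorphicRepData (AutomorphyDatum.gl 6 F (hF 6)),
      (∀ᶠ v : HeightOneSpectrum (𝓞 F) in cofinite, ∀ α : Multiset ℂ,
        π₁.1.HasSatakeParamAt v α → P₁.HasSatakeParamAt v (wedgeTwoParams α)) ∧
      (∀ χ₁ : (F →+* ℂ) → Multiset ℂ, π₁.1.HasArchParameter χ₁ →
        P₁.HasArchParameter fun σ : F →+* ℂ => wedgeTwoArchParams (χ₁ σ)) ∧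
      ∃ (k : ℕ) (m : Fin k → ℕ) (σ : ∀ i : Fin k, CuspidalAutomorphicRepData (m i) F (hF (m i))),
        (∑ i, m i = 6) ∧
        ∀ᶠ v : HeightOneSpectrum (𝓞 F) in cofinite, ∀ β : Fin k → Multiset ℂ,
          (∀ i, (σ i).1.HasSatakeParamAt v (β i)) → P₁.HasSatakeParamAt v (∑ i, β i) := by
  obtain ⟨P, hP, hParch, k, m, σ, hm, hσ⟩ := h
  -- the twisted lift `P₁ = P ⊗ (χ² ∘ det)` and its Satake parameters
  obtain ⟨P₁, hPW, hPW'⟩ := exists_automorphicRepData_twist_hecke (χ * χ) P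
  have hP₁ := AutomorphicRepData.eventually_hasSatakeParamAt_of_map_mulChar_detTwist (χ * χ) hPW hPW'
  -- Satake parameters of `π₁` transfer back to `π`
  have hπ := AutomorphicRepData.eventually_hasSatakeParamAt_of_map_mulChar_detTwist_symm χ hW hW'
  -- `π = π₁ ⊗ (χ⁻¹ ∘ det)` on the nose
  have hWs : π.1.W = π₁.1.W.map (mulChar (detTwist 4 χ⁻¹)) := by
    rw [hW, detTwist_inv, map_mulChar_inv_map_mulChar]
  have hW's : π.1.W' = π₁.1.W'.map (mulChar (detTwist 4 χ⁻¹)) := by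
    rw [hW', detTwist_inv, map_mulChar_inv_map_mulChar]
  -- the twisted cuspidal data `σᵢ ⊗ (χ² ∘ det)` (for `nᵢ = 0` there is nothing to twist)
  have key : ∀ i : Fin k, ∃ τ : CuspidalAutomorphicRepData (m i) F (hF (m i)),
      ∀ᶠ v : HeightOneSpectrum (𝓞 F) in cofinite, ∀ β : Multiset ℂ,
        τ.1.HasSatakeParamAt v β →
          (σ i).1.HasSatakeParamAt v (β.map ((((χ * χ).valueAtUniformizer v)⁻¹) * ·)) := by
    intro i
    rcases Nat.eq_zero_or_pos (m i) with h0 | hpos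
    · refine ⟨σ i, Filter.Eventually.of_forall fun v β hβ => ?_⟩
      have hβ0 : β = 0 := Multiset.card_eq_zero.mp (hβ.card_eq.trans h0)
      simpa only [hβ0, Multiset.map_zero] using hβ
    · haveI : NeZero (m i) := ⟨hpos.ne'⟩
      obtain ⟨τ, hτW, hτW'⟩ := exists_cuspidalAutomorphicRepData_twist_hecke (χ * χ) (σ i)
      exact ⟨τ, AutomorphicRepData.eventually_hasSatakeParamAt_of_map_mulChar_detTwist_symm
        (χ * χ) hτW hτW'⟩
  choose τ hτ using key
  refine ⟨P₁, ?_, ?_, k, m, τ, hm, ?_⟩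
  · -- clause (i): `∧²(χ α) = χ² ∧² α`
    filter_upwards [hπ, hP, hP₁] with v h1 h2 h3 α₁ hα₁
    have hc : χ.valueAtUniformizer v ≠ 0 := valueAtUniformizer_ne_zero'' χ v
    have step := h3 _ (h2 _ (h1 α₁ hα₁))
    rw [wedgeTwoParams_map_mul, GaloisRepresentations.HeckeCharacter.valueAtUniformizer_mul,
      map_mul_map_mul_of_mul_eq_one' (by field_simp)] at step
    exact step
  · -- clause (ii): `∧²(χ₁ - s) + 2s = ∧² χ₁`
    intro χ₁ hχ₁
    have h1 : π.1.HasArchParameter fun σ => (χ₁ σ).map (· + (((-s : ℝ) : ℝ) : ℂ)) :=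
      AutomorphicRepData.HasArchParameter.of_map_mulChar_detTwist
        (inv_apply_eq_ideleNorm_cpow_neg hχ) hWs hW's hχ₁
    have h2 := hParch _ h1
    have h3 := AutomorphicRepData.HasArchParameter.of_map_mulChar_detTwist
      (mul_self_apply_eq_ideleNorm_cpow_two_mul hχ) hPW hPW' h2
    convert h3 using 2 with σ
    rw [wedgeTwoArchParams_map_add, map_add_map_add_of_add_eq_zero]
    push_cast
    ring
  · -- clause (iii): `⊎ᵢ χ² βᵢ = χ² ⊎ᵢ βᵢ`
    filter_upwards [Filter.eventually_all.2 hτ, hσ, hP₁] with v H h2 h3 β hβ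
    have hc : (χ * χ).valueAtUniformizer v ≠ 0 := valueAtUniformizer_ne_zero'' (χ * χ) v
    have step := h3 _ (h2 (fun i => (β i).map ((((χ * χ).valueAtUniformizer v)⁻¹) * ·))
      fun i => H i (β i) (hβ i))
    rw [← multiset_map_sum', map_mul_map_mul_of_mul_eq_one' (mul_inv_cancel₀ hc)] at step
    exact step

/-- **The conclusion of Theorem A (with its archimedean clause) along a near-equivalence that
respects archimedean parameters.** If `π` and `π₁` are nearly equivalent cuspidal data on
`GL₄(𝔸_F)` (a common Satake parameter at almost every `v`), every archimedean parameter of `π₁` is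
one of `π`, and the conclusion of `Kim2003_exteriorSquare_GL4_archimedean` holds for `π`, then it
holds for `π₁` with the same `P` and the same `σᵢ` (uniqueness of Satake parameters of `π₁`,
`AutomorphicRepData.hasSatakeParamAt_unique_holds`, Flath 1979, Thm. 3). The archimedean hypothesis
is what a model `π₁ ≅ π` as `(𝔤, K_∞) × GL₄(𝔸_F^∞)`-modules supplies (same infinitesimal
character); near-equivalence alone does not. Jacquet–Shalika 1981, §4; Clozel 1990, §3.3.
[cite: Kim2002, Theorem A (p. 139)] -/
theorem Kim2003_exteriorSquare_GL4_archimedean.conclusion_of_isNearlyEquivalent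
    {π π₁ : CuspidalAutomorphicRepData 4 F (hF 4)}
    (hne : AutomorphicRepData.IsNearlyEquivalent π.1 π₁.1)
    (harch : ∀ χ₁ : (F →+* ℂ) → Multiset ℂ, π₁.1.HasArchParameter χ₁ → π.1.HasArchParameter χ₁)
    (h : ∃ P : AutomorphicRepData (AutomorphyDatum.gl 6 F (hF 6)),
      (∀ᶠ v : HeightOneSpectrum (𝓞 F) in cofinite, ∀ α : Multiset ℂ,
        π.1.HasSatakeParamAt v α → P.HasSatakeParamAt v (wedgeTwoParams α)) ∧
      (∀ χ₀ : (F →+* ℂ) → Multiset ℂ, π.1.HasArchParameter χ₀ →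
        P.HasArchParameter fun σ : F →+* ℂ => wedgeTwoArchParams (χ₀ σ)) ∧
      ∃ (k : ℕ) (m : Fin k → ℕ) (σ : ∀ i : Fin k, CuspidalAutomorphicRepData (m i) F (hF (m i))),
        (∑ i, m i = 6) ∧
        ∀ᶠ v : HeightOneSpectrum (𝓞 F) in cofinite, ∀ β : Fin k → Multiset ℂ,
          (∀ i, (σ i).1.HasSatakeParamAt v (β i)) → P.HasSatakeParamAt v (∑ i, β i)) :
    ∃ P₁ : AutomorphicRepData (AutomorphyDatum.gl 6 F (hF 6)),
      (∀ᶠ v : HeightOneSpectrum (𝓞 F) in cofinite, ∀ α : Multiset ℂ,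
        π₁.1.HasSatakeParamAt v α → P₁.HasSatakeParamAt v (wedgeTwoParams α)) ∧
      (∀ χ₁ : (F →+* ℂ) → Multiset ℂ, π₁.1.HasArchParameter χ₁ →
        P₁.HasArchParameter fun σ : F →+* ℂ => wedgeTwoArchParams (χ₁ σ)) ∧
      ∃ (k : ℕ) (m : Fin k → ℕ) (σ : ∀ i : Fin k, CuspidalAutomorphicRepData (m i) F (hF (m i))),
        (∑ i, m i = 6) ∧
        ∀ᶠ v : HeightOneSpectrum (𝓞 F) in cofinite, ∀ β : Fin k → Multiset ℂ,
          (∀ i, (σ i).1.HasSatakeParamAt v (β i)) → P₁.HasSatakeParamAt v (∑ i, β i) := by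
  obtain ⟨P, hP, hParch, hrest⟩ := h
  refine ⟨P, ?_, fun χ₁ hχ₁ => hParch χ₁ (harch χ₁ hχ₁), hrest⟩
  filter_upwards [hne, hP] with v hv h1 α₁ hα₁
  obtain ⟨α₀, hα₀, hα₀'⟩ := hv
  have heq : α₁ = α₀ := AutomorphicRepData.hasSatakeParamAt_unique_holds π₁.1 hα₁ hα₀'
  rw [heq]
  exact h1 α₀ hα₀

end Kim

/-! ### Reduction of the fact to unitary-normalised cuspidal data (Kim's printed hypothesis) -/

section Reduction

/-- **`Kim2003_exteriorSquare_GL4_archimedean` follows from its case of cuspidal data with purely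
imaginary central exponent at infinity.** For a cuspidal datum `π` on `GL₄(𝔸_F)` with archimedean
parameter `χ` (`n = 4` entries `χ(σ)ᵢ` at each of the `[F:ℚ]` complex embeddings `σ`), the split
component `A_G = ℝ_{>0}` of the centre acts on `π_∞` by `a ↦ a^μ`, `μ = ∑_σ ∑ᵢ χ(σ)ᵢ` (the central
`1 ∈ 𝔤𝔩₄(F_w)` acts through the infinitesimal character by the sum of the Harish-Chandra entries
at the embeddings over `w`); `Re μ = 0` says that the central character of `π_∞` is unitary on `A_G` —
for an irreducible cuspidal automorphic representation, that `π` is unitary: Kim's standing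
convention "a cuspidal representation always means a unitary one" (p. 139), the general case
being `π = π⁰ ⊗ |det|^s` (Borel–Jacquet 1979, 5.7). Granted the
conclusion of the fact for all cuspidal `π` with `Re ∑_σ ∑ᵢ χ(σ)ᵢ = 0` for every archimedean
parameter `χ` of `π`, it holds for every cuspidal `π`: if `π` has no archimedean parameter the
hypothesis applies to `π` itself; otherwise twist by `|det|_𝔸^s`, `s = -Re μ / 4[F:ℚ]`
(`exists_heckeCharacter_ideleNorm_cpow`, `exists_cuspidalAutomorphicRepData_twist_hecke`): the
twist has the unique archimedean parameter `χ + s` (`HasArchParameter.of_map_mulChar_detTwist`,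
`hasArchParameter_unique`), of total exponent `μ + 4[F:ℚ]s`, and the conclusion comes back
along `‖·‖^{-s}` by `Kim2003_exteriorSquare_GL4_archimedean.conclusion_of_twist_norm`.
Borel–Jacquet 1979, 5.7; Kim 2003, p. 139. [cite: Kim2002, §1 p. 139 (convention "cuspidal = unitary cuspidal")] -/
theorem Kim2003_exteriorSquare_GL4_archimedean_of_re_centralExponent_eq_zero
    (H : ∀ (F : Type) [Field F] [NumberField F] (hF : ∀ m : ℕ, isCompact_glFiniteIntegralLevel m F)
      (π : CuspidalAutomorphicRepData 4 F (hF 4)),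
      (∀ χ : (F →+* ℂ) → Multiset ℂ, π.1.HasArchParameter χ →
        (∑ σ : F →+* ℂ, (χ σ).sum).re = 0) →
      ∃ P : AutomorphicRepData (AutomorphyDatum.gl 6 F (hF 6)),
        (∀ᶠ v : HeightOneSpectrum (𝓞 F) in cofinite, ∀ α : Multiset ℂ,
          π.1.HasSatakeParamAt v α → P.HasSatakeParamAt v (wedgeTwoParams α)) ∧
        (∀ χ : (F →+* ℂ) → Multiset ℂ, π.1.HasArchParameter χ →
          P.HasArchParameter fun σ : F →+* ℂ => wedgeTwoArchParams (χ σ)) ∧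
        ∃ (k : ℕ) (m : Fin k → ℕ) (σ : ∀ i : Fin k, CuspidalAutomorphicRepData (m i) F (hF (m i))),
          (∑ i, m i = 6) ∧
          ∀ᶠ v : HeightOneSpectrum (𝓞 F) in cofinite, ∀ β : Fin k → Multiset ℂ,
            (∀ i, (σ i).1.HasSatakeParamAt v (β i)) → P.HasSatakeParamAt v (∑ i, β i)) :
    Kim2003_exteriorSquare_GL4_archimedean := by
  intro F _ _ hF π
  by_cases hex : ∃ χ₀ : (F →+* ℂ) → Multiset ℂ, π.1.HasArchParameter χ₀
  swap
  · exact H F hF π fun χ hχ => (hex ⟨χ, hχ⟩).elim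
  obtain ⟨χ₀, hχ₀⟩ := hex
  -- the central exponent `μ` and the normalising real twist `s = -Re μ / 4[F:ℚ]`
  set μ : ℂ := ∑ σ : F →+* ℂ, (χ₀ σ).sum with hμ
  have hd : (4 * (Module.finrank ℚ F : ℝ)) ≠ 0 :=
    mul_ne_zero four_ne_zero (Nat.cast_ne_zero.2 Module.finrank_pos.ne')
  set s : ℝ := -μ.re / (4 * (Module.finrank ℚ F : ℝ)) with hsdef
  have hs : μ.re + 4 * (Module.finrank ℚ F : ℝ) * s = 0 := by
    rw [hsdef, mul_div_cancel₀ _ hd, add_neg_cancel]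
  obtain ⟨χ, hχ⟩ := exists_heckeCharacter_ideleNorm_cpow F ((s : ℝ) : ℂ)
  -- the twist `π₁ = π ⊗ |det|_𝔸^s` and its (unique) archimedean parameter `χ₀ + s`
  obtain ⟨π₁, hW, hW'⟩ := exists_cuspidalAutomorphicRepData_twist_hecke χ π
  have h₁ : π₁.1.HasArchParameter fun σ => (χ₀ σ).map (· + ((s : ℝ) : ℂ)) :=
    AutomorphicRepData.HasArchParameter.of_map_mulChar_detTwist hχ hW hW' hχ₀
  have hcard : ∀ σ : F →+* ℂ, Multiset.card (χ₀ σ) = 4 := fun σ =>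
    AutomorphicRepData.card_eq_of_hasArchParameter hχ₀ σ
  have hcond : ∀ χ₁ : (F →+* ℂ) → Multiset ℂ, π₁.1.HasArchParameter χ₁ →
      (∑ σ : F →+* ℂ, (χ₁ σ).sum).re = 0 := by
    intro χ₁ hχ₁
    obtain rfl : χ₁ = fun σ => (χ₀ σ).map (· + ((s : ℝ) : ℂ)) :=
      π₁.1.hasArchParameter_unique hχ₁ h₁
    have e : ∀ σ : F →+* ℂ, ((χ₀ σ).map (· + ((s : ℝ) : ℂ))).sum = (χ₀ σ).sum + 4 * (s : ℂ) := by
      intro σ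
      rw [Multiset.sum_map_add, Multiset.map_id', Multiset.map_const', Multiset.sum_replicate,
        hcard σ, nsmul_eq_mul, Nat.cast_ofNat]
    simp only [e, Finset.sum_add_distrib, Finset.sum_const, Finset.card_univ,
      NumberField.Embeddings.card, nsmul_eq_mul]
    rw [← hμ, Complex.add_re]
    have : ((Module.finrank ℚ F : ℂ) * (4 * (s : ℂ))).re = 4 * (Module.finrank ℚ F : ℝ) * s := by
      rw [show ((Module.finrank ℚ F : ℂ) * (4 * (s : ℂ))) =
          ((4 * (Module.finrank ℚ F : ℝ) * s : ℝ) : ℂ) by push_cast; ring, Complex.ofReal_re]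
    rw [this]
    exact hs
  -- Theorem A for `π₁`, transported back to `π = π₁ ⊗ |det|_𝔸^{-s}`
  have hconc := H F hF π₁ hcond
  have hWs : π.1.W = π₁.1.W.map (mulChar (detTwist 4 χ⁻¹)) := by
    rw [hW, detTwist_inv, map_mulChar_inv_map_mulChar]
  have hW's : π.1.W' = π₁.1.W'.map (mulChar (detTwist 4 χ⁻¹)) := by
    rw [hW', detTwist_inv, map_mulChar_inv_map_mulChar]
  exact Kim2003_exteriorSquare_GL4_archimedean.conclusion_of_twist_norm F hF
    (inv_apply_eq_ideleNorm_cpow_neg hχ) hWs hW's hconc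

end Reduction

end Literature.NumberTheory.Automorphic

end
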